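import Literature.AlgebraicGeometry.Resolution.NearPointsPointCentreLineLocal
import Literature.AlgebraicGeometry.Resolution.BlowupStalkCharts
import Literature.AlgebraicGeometry.Resolution.BlowupDimension
import Literature.AlgebraicGeometry.Resolution.TauOneAdaptedCoordinates
import Literature.AlgebraicGeometry.Resolution.StrictNormalCrossingsFlatDescent
import Literature.AlgebraicGeometry.Resolution.StalkIdealGenerization
import Literature.AlgebraicGeometry.Resolution.SubschemeRegularStalks
import Literature.AlgebraicGeometry.Resolution.PointCentrePermissible
import Literature.AlgebraicGeometry.Resolution.RegularBlowup
import Literature.AlgebraicGeometry.Resolution.RegularCentreBlowupOrder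
import Literature.AlgebraicGeometry.Resolution.CurveCentreTwoParameters
import Literature.AlgebraicGeometry.Resolution.GenericPointStalkData
import Literature.AlgebraicGeometry.Resolution.OrderSemicontinuityPointwise
import HarnessLib

/-!
# The line of near points over a `τ = 1` point centre is a regular curve: the closure of a non-closed near point
# (CoP1, Lemma 4.3 (5): "those points `x′ ∈ q⁻¹(x)` near `x` all lie on the projective line `L_x`")

Topic: `Literature/AlgebraicGeometry/Resolution`. [CoP1] = Cossart–Piltant, J. Algebra 320 (2008) 1051–1082, Lemma 4.3 (5), p. 8, and the
structure (*) of the proof of Prop. 4.4, p. 10–11: "`Σ(i)` is a disjoint union of closed points and projective lines … each exceptional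
curve in `Σ(i+1)` created by the algorithm is regular". The tree places every near point over a `τ(x) = 1` point centre on the strict
transform of the directrix hypersurface and proves that the line is a REGULAR CURVE GERM `(c_j, c_{j₀}/c_j)` at each near point
(`NearPointsPointCentreLine(Local).lean`); announced there as «not here»: the line as a global closed subset and its generic point. PROVED
here, in the form the REACH step of Prop. 4.4 consumes (census row ρ1 `pointStep_curves` of the res-hironaka inputs cell), WITHOUT
constructing `ℙ²`: if `η′` is a NON-CLOSED near point over the closed point `x` (so `τ(x) = 1`), then at every point `y` of its closure
`L = cl{η′}` the ideal `𝓘_{L,y}` IS the line germ `(c_j, c_{j₀}/c_j)` — because the germ is a prime contained in the prime of `η′`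
(the relation `c_{j₀} = c_j · w` specialises from `y` to `η′`, where `w` becomes a non-unit) and `dim 𝒪_{X′,η′} = 2`, `dim 𝒪_{X′,y} = 3`.
Hence:

* `IsBlowup.isNear_of_specializes_of_isNear_point`, `IsBlowup.coheight_le_three_of_apply_eq` — bookkeeping over a point centre;
* `IsBlowup.exists_line_germ_of_isNear_of_sections` — Lemma 4.3 (5) at a near point over `x` with the coordinates given by SECTIONS
  (transport along `π y = x`); `exists_adapted_sections` — adapted coordinates as sections (`TauOneAdaptedCoordinates.lean`);
* `IsBlowup.stalkIdeal_vanishingIdeal_closure_eq_span_lineGerm` — **the core theorem: for every non-closed near point `η′` over `x`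
  specialising to the near point `y`, `𝓘_{cl η′, y} = (g_j, g_{j₀}/g_j)`, the line germ at `y`.**
The consequences (regular curve, rsop pairs, equal-or-disjoint, `τ(x) = 1`) are in `NearPointsPointCentreLineCurve.lean`.

No definitions, no named facts. AI-written; weaker than expert review.

## Sources

* V. Cossart, O. Piltant, J. Algebra 320 (2008) 1051–1082, Lemma 4.3 (1), (3), (5) and proof of Prop. 4.4 (*), pp. 8–11. [CossartPiltant2008]
* V. Cossart, U. Jannsen, S. Saito, LNM 2270 (2020), Def. 6.38 (ii). [CossartJannsenSaito2020]
-/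

noncomputable section

open CategoryTheory AlgebraicGeometry TopologicalSpace IsLocalRing

namespace Literature.AlgebraicGeometry.Resolution

universe u

open Scheme.IdealSheafData

variable {X X' : Scheme.{u}} {π : X' ⟶ X}

/-! ## Bookkeeping at a point centre -/

/-- Points over a closed point centre: a specialisation of a point over `x` lies over `x`. [folklore] -/
private theorem apply_eq_of_specializes_of_apply_eq {x : X} (hx : IsClosed ({x} : Set X)) {η' y : X'} (h : η' ⤳ y) (hη : π η' = x) :
    π y = x := by
  have h' : π η' ⤳ π y := h.map π.continuous
  rw [hη] at h'
  exact h'.mem_closed hx (Set.mem_singleton x)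

/-- Over a point centre `Y = {x} ⊆ {ord J = μ}`: every point of the weak transform's order-`μ` locus over `x` that is a specialisation of
a near point is near. [cite: CossartPiltant2008, Prop. 4.2 (proof, (a))] -/
theorem IsBlowup.isNear_of_specializes_of_isNear_point [IsLocallyNoetherian X] [IsLocallyNoetherian X']
    (hX : Scheme.IsRegular X) (hX' : Scheme.IsRegular X') {x : X} (hx : IsClosed ({x} : Set X))
    (hπ : IsBlowup π (vanishingIdeal ⟨{x}, hx⟩)) {J : X.IdealSheafData} {μ : ℕ} (hord : idealOrder J x = μ)
    {η' y : X'} (hnear : IsNear π (vanishingIdeal ⟨{x}, hx⟩) J μ η') (hη : π η' = x) (h : η' ⤳ y) :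
    IsNear π (vanishingIdeal ⟨{x}, hx⟩) J μ y := by
  haveI := hX' y
  have hy : π y = x := apply_eq_of_specializes_of_apply_eq hx h hη
  have hY : ∀ z ∈ ((⟨{x}, hx⟩ : Closeds X) : Set X), idealOrder J z = μ := by
    rintro z (rfl : z = x); exact hord
  have hle : idealOrder (controlledTransform π (vanishingIdeal ⟨{x}, hx⟩) J μ) y ≤ μ :=
    hπ.idealOrder_controlledTransform_le_of_mem hX (isRegular_subscheme_vanishingIdeal_singleton hx) hY
      (by rw [hy]; rfl)
  have hge : (μ : ℕ∞) ≤ idealOrder (controlledTransform π (vanishingIdeal ⟨{x}, hx⟩) J μ) y :=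
    (isNear_iff.mp hnear).ge.trans (idealOrder_le_of_specializes h _)
  exact isNear_iff.mpr (le_antisymm hle hge)

/-! ## The line germ at a point over `x`, from sections -/

/-- **Lemma 4.3 (5) at a point over `x`, with the coordinates given by SECTIONS** (so that the statement transports along `π y = x`):
for sections `g₀, g₁, g₂` over `U ∋ x` whose germs form a regular system of parameters at `x` adapted at the indices `≠ j₀`
(`τ(x) = 1`), at every near point `y` over `x` there are `j ≠ j₀` and `w ∈ 𝒪_{X′,y}` with `𝔪_x 𝒪_{X′,y} = (g_j)`, `g_{j₀} = g_j · w` and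
`(g_j, w)` part of a regular system of parameters of `𝒪_{X′,y}` (germs of `π^*g` at `y`). [cite: CossartPiltant2008, Lemma 4.3 (5)] -/
theorem IsBlowup.exists_line_germ_of_isNear_of_sections [IsLocallyNoetherian X] [IsLocallyNoetherian X'] {x : X}
    (hx : IsClosed ({x} : Set X)) (hπ : IsBlowup π (vanishingIdeal ⟨{x}, hx⟩)) {J : X.IdealSheafData} {μ : ℕ}
    [IsRegularLocalRing (X.presheaf.stalk x)] (hd : (maximalIdeal (X.presheaf.stalk x)).spanFinrank = 3)
    {U : X.Opens} (hxU : x ∈ U) (g : Fin 3 → Γ(X, U))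
    (hc : Ideal.span (Set.range fun i => X.presheaf.germ U x hxU (g i)) = maximalIdeal _) (j₀ : Fin 3)
    (hτ : stalkTau J x μ = 1) (had : ∀ i, i ≠ j₀ → IsAdapted (fun i => X.presheaf.germ U x hxU (g i)) (stalkIdeal J x) μ i)
    {y : X'} (hy : π y = x) (hnear : IsNear π (vanishingIdeal ⟨{x}, hx⟩) J μ y) :
    ∃ (j : Fin 3) (hyU : y ∈ π ⁻¹ᵁ U) (w : X'.presheaf.stalk y), j ≠ j₀ ∧
      (maximalIdeal (X.presheaf.stalk (π y))).map (π.stalkMap y).hom =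
        Ideal.span {X'.presheaf.germ (π ⁻¹ᵁ U) y hyU (π.app U (g j))} ∧
      X'.presheaf.germ (π ⁻¹ᵁ U) y hyU (π.app U (g j₀)) = X'.presheaf.germ (π ⁻¹ᵁ U) y hyU (π.app U (g j)) * w ∧
      IsRsopPart ![X'.presheaf.germ (π ⁻¹ᵁ U) y hyU (π.app U (g j)), w] := by
  subst hy
  have hyU : y ∈ π ⁻¹ᵁ U := hxU
  have hcY : Ideal.span (Set.range fun i => X.presheaf.germ U (π y) hxU (g i)) =
      stalkIdeal (vanishingIdeal ⟨{π y}, hx⟩) (π y) := by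
    rw [hc, stalkIdeal_vanishingIdeal_singleton hx]
  obtain ⟨j, w, hj, hmap, hrel, hrsop⟩ :=
    hπ.exists_isRsopPart_line_of_isNear_point_of_stalkTau_eq_one hd hc hcY j₀ hτ had hnear
  have hgerm : ∀ i, (π.stalkMap y).hom (X.presheaf.germ U (π y) hxU (g i)) =
      X'.presheaf.germ (π ⁻¹ᵁ U) y hyU (π.app U (g i)) := fun i => Scheme.Hom.germ_stalkMap_apply π U y hxU (g i)
  refine ⟨j, hyU, w, hj, ?_, ?_, ?_⟩
  · rw [hmap, hgerm]
  · rw [← hgerm, ← hgerm]; exact hrel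
  · rw [← hgerm]; exact hrsop

/-! ## The closure of a non-closed near point -/

/-- Over a closed point `x` with regular three-dimensional local ring, every point of the blowing up of `x` has codimension `≤ 3` (its
local ring is a localisation of a chart ring of `Bl_𝔪 Spec 𝒪_{X,x}`, Matsumura 15.5). [cite: Matsumura1987, Thm. 15.5] -/
theorem IsBlowup.coheight_le_three_of_apply_eq [IsLocallyNoetherian X] [IsLocallyNoetherian X'] (hX : Scheme.IsRegular X)
    {x : X} {hx : IsClosed ({x} : Set X)} (hπ : IsBlowup π (vanishingIdeal ⟨{x}, hx⟩))
    (hdim : (maximalIdeal (X.presheaf.stalk x)).spanFinrank = 3) {z : X'} (hz : π z = x) :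
    Order.coheight z ≤ 3 := by
  subst hz
  haveI : IsRegularLocalRing (X.presheaf.stalk (π z)) := hX (π z)
  haveI := isDomain_of_isRegularLocalRing (X.presheaf.stalk (π z))
  obtain ⟨c₃, hc₃⟩ := exists_regularSystemOfParameters (R := X.presheaf.stalk (π z))
  have hcY : Ideal.span (Set.range c₃) = stalkIdeal (vanishingIdeal ⟨{π z}, hx⟩) (π z) := by
    rw [hc₃, stalkIdeal_vanishingIdeal_singleton hx]
  obtain ⟨j, 𝔴, χ, -, hloc, h𝔴⟩ := hπ.exists_reesChart_stalk z c₃ hcY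
  letI := χ.toAlgebra
  haveI : IsLocalization.AtPrime (X'.presheaf.stalk z) 𝔴.asIdeal := hloc
  have h := ringKrullDim_localization_chartRing_le c₃ j 𝔴.asIdeal h𝔴 (X'.presheaf.stalk z)
  rw [ringKrullDim_stalk_eq_coheight z, ← IsRegularLocalRing.spanFinrank_maximalIdeal, hdim, Nat.cast_ofNat,
    ← WithBot.coe_ofNat, WithBot.coe_le_coe] at h
  exact h

/-- Adapted coordinates at `x` ([CoP1] p. 9: «we may now choose `(y₁, y₂, y₃)` in such a way that `T_x = k(x).Y₃`»), represented by
SECTIONS over a common open `U ∋ x` (for transport along `π y = x`). [cite: CossartPiltant2008, Lemma 4.3 (5) (proof)] -/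
theorem exists_adapted_sections [IsLocallyNoetherian X] (hX : Scheme.IsRegular X) {x : X} {J : X.IdealSheafData} {μ : ℕ}
    (hdim : (maximalIdeal (X.presheaf.stalk x)).spanFinrank = 3) (hτ : haveI := hX x; stalkTau J x μ = 1) :
    ∃ (U : X.Opens) (hxU : x ∈ U) (g : Fin 3 → Γ(X, U)),
      Ideal.span (Set.range fun i => X.presheaf.germ U x hxU (g i)) = maximalIdeal _ ∧
      ∃ j₀ : Fin 3, ∀ i, i ≠ j₀ → IsAdapted (fun i => X.presheaf.germ U x hxU (g i)) (stalkIdeal J x) μ i := by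
  haveI hRx : IsRegularLocalRing (X.presheaf.stalk x) := hX x
  obtain ⟨c, j₀, hc, had⟩ := exists_rsop_forall_ne_isAdapted_of_stalkTau_eq_one J x hdim hτ
  obtain ⟨U, hxU, g, hg⟩ : ∃ (U : X.Opens) (hxU : x ∈ U) (g : Fin 3 → Γ(X, U)),
      ∀ i, X.presheaf.germ U x hxU (g i) = c i := by
    choose U hxU t ht using fun i => X.presheaf.exists_germ_eq (c i)
    have hle : ∀ i : Fin 3, U 0 ⊓ U 1 ⊓ U 2 ≤ U i := by
      intro i
      fin_cases i
      · exact inf_le_left.trans inf_le_left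
      · exact inf_le_left.trans inf_le_right
      · exact inf_le_right
    refine ⟨U 0 ⊓ U 1 ⊓ U 2, Opens.mem_inf.mpr ⟨Opens.mem_inf.mpr ⟨hxU 0, hxU 1⟩, hxU 2⟩,
      fun i => X.presheaf.map (homOfLE (hle i)).op (t i), fun i => ?_⟩
    rw [TopCat.Presheaf.germ_res_apply]
    exact ht i
  have hfun : (fun i => X.presheaf.germ U x hxU (g i)) = c := funext hg
  refine ⟨U, hxU, g, by rw [hfun]; exact hc, j₀, fun i hi => by rw [hfun]; exact had i hi⟩

/-- **Core of Lemma 4.3 (5), global form.** With the coordinates given by sections `g` adapted at the indices `≠ j₀` (`τ(x) = 1`), let `y`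
be a near point over `x` with its line germ `(g_j, w)` (`𝔪_x 𝒪_{X′,y} = (g_j)`, `g_{j₀} = g_j · w`, `(g_j, w)` an rsop pair — the output
of `IsBlowup.exists_line_germ_of_isNear_of_sections`). Then for EVERY non-closed near point `η′` over `x` specialising to `y`, the ideal
of `cl{η′}` at `y` IS the line germ: `𝓘_{cl η′, y} = (g_j, w)`. (So all such `η′` have the same ideal at `y`.)
[cite: CossartPiltant2008, Lemma 4.3 (5); Prop. 4.4 (proof, (*))] -/
theorem IsBlowup.stalkIdeal_vanishingIdeal_closure_eq_span_lineGerm [IsLocallyNoetherian X] [IsLocallyNoetherian X']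
    (hX : Scheme.IsRegular X) {x : X} (hx : IsClosed ({x} : Set X)) (hπ : IsBlowup π (vanishingIdeal ⟨{x}, hx⟩))
    {J : X.IdealSheafData} {μ : ℕ} (hord : idealOrder J x = μ) (hdim : (maximalIdeal (X.presheaf.stalk x)).spanFinrank = 3)
    (hτ : haveI := hX x; stalkTau J x μ = 1) {U : X.Opens} (hxU : x ∈ U) (g : Fin 3 → Γ(X, U))
    (hcg : Ideal.span (Set.range fun i => X.presheaf.germ U x hxU (g i)) = maximalIdeal _) (j₀ : Fin 3)
    (hadg : ∀ i, i ≠ j₀ → IsAdapted (fun i => X.presheaf.germ U x hxU (g i)) (stalkIdeal J x) μ i)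
    {y : X'} (hyx : π y = x) {j : Fin 3} (hyU : y ∈ π ⁻¹ᵁ U) {w : X'.presheaf.stalk y}
    (hmap_y : (maximalIdeal (X.presheaf.stalk (π y))).map (π.stalkMap y).hom =
      Ideal.span {X'.presheaf.germ (π ⁻¹ᵁ U) y hyU (π.app U (g j))})
    (hrel_y : X'.presheaf.germ (π ⁻¹ᵁ U) y hyU (π.app U (g j₀)) = X'.presheaf.germ (π ⁻¹ᵁ U) y hyU (π.app U (g j)) * w)
    (hrsop_y : IsRsopPart ![X'.presheaf.germ (π ⁻¹ᵁ U) y hyU (π.app U (g j)), w])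
    {η' : X'} (hη : π η' = x) (hnear : IsNear π (vanishingIdeal ⟨{x}, hx⟩) J μ η') (hηcl : ¬ IsClosed ({η'} : Set X'))
    (hsp : η' ⤳ y) :
    stalkIdeal (vanishingIdeal (⟨closure {η'}, isClosed_closure⟩ : Closeds X')) y =
      Ideal.span (Set.range ![X'.presheaf.germ (π ⁻¹ᵁ U) y hyU (π.app U (g j)), w]) := by
  classical
  haveI hRx : IsRegularLocalRing (X.presheaf.stalk x) := hX x
  have hX' : Scheme.IsRegular X' := hπ.isRegular_of_isRegular_subscheme hX (isRegular_subscheme_vanishingIdeal_singleton hx)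
  have hgmem : ∀ (z : X) (hz : z = x) (hzU : z ∈ U) (i : Fin 3),
      X.presheaf.germ U z hzU (g i) ∈ maximalIdeal (X.presheaf.stalk z) := by
    rintro z rfl hzU i
    exact hcg ▸ Ideal.subset_span ⟨i, rfl⟩
  obtain ⟨j', hηU, w', hj', hmap_η, hrel_η, hrsop_η⟩ :=
    hπ.exists_line_germ_of_isNear_of_sections hx hdim hxU g hcg j₀ hτ hadg hη hnear
  -- notation for the germs of `π^* g`
  let G : Fin 3 → X'.presheaf.stalk y := fun i => X'.presheaf.germ (π ⁻¹ᵁ U) y hyU (π.app U (g i))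
  let G' : Fin 3 → X'.presheaf.stalk η' := fun i => X'.presheaf.germ (π ⁻¹ᵁ U) η' hηU (π.app U (g i))
  have hmap_y' : (maximalIdeal (X.presheaf.stalk (π y))).map (π.stalkMap y).hom = Ideal.span {G j} := hmap_y
  have hrel_y' : G j₀ = G j * w := hrel_y
  have hrsop_y' : IsRsopPart ![G j, w] := hrsop_y
  have hmap_η' : (maximalIdeal (X.presheaf.stalk (π η'))).map (π.stalkMap η').hom = Ideal.span {G' j'} := hmap_η
  have hrel_η' : G' j₀ = G' j' * w' := hrel_η
  have hrsop_η' : IsRsopPart ![G' j', w'] := hrsop_η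
  let s : X'.presheaf.stalk y →+* X'.presheaf.stalk η' := (X'.presheaf.stalkSpecializes hsp).hom
  have hsG : ∀ i, s (G i) = G' i := fun i => TopCat.Presheaf.germ_stalkSpecializes_apply _ _ _ _
  haveI : IsRegularLocalRing (X'.presheaf.stalk y) := hX' y
  haveI : IsRegularLocalRing (X'.presheaf.stalk η') := hX' η'
  haveI := isDomain_of_isRegularLocalRing (X'.presheaf.stalk η')
  -- `coheight η' = 2`: `≥ 2` by the rsop pair, `≤ 2` as `η'` is not closed and codimensions over `x` are `≤ 3`
  obtain ⟨y₀, hy₀, hy₀ne⟩ : ∃ y₀ ∈ closure ({η'} : Set X'), y₀ ≠ η' := by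
    by_contra h
    push Not at h
    apply hηcl
    have : closure ({η'} : Set X') = {η'} := Set.Subset.antisymm (fun z hz => h z hz) subset_closure
    rw [← this]; exact isClosed_closure
  have hcohη : Order.coheight η' = 2 := by
    have hsp₀ : η' ⤳ y₀ := specializes_iff_mem_closure.mpr hy₀
    have hns : ¬ y₀ ⤳ η' := fun h' => hy₀ne (Specializes.antisymm h' hsp₀).eq
    have h2 : (1 : ℕ∞) < Order.coheight η' := by
      -- `dim 𝒪_{η'} = dim (𝒪_{η'}/(G' j', w')) + 2 ≥ 2`
      have hadd := hrsop_η'.ringKrullDim_quotient_add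
      haveI : Nontrivial (X'.presheaf.stalk η' ⧸ Ideal.span (Set.range ![G' j', w'])) :=
        Ideal.Quotient.nontrivial_iff.mpr hrsop_η'.span_range_ne_top
      have h0 : (0 : WithBot ℕ∞) ≤ ringKrullDim (X'.presheaf.stalk η' ⧸ Ideal.span (Set.range ![G' j', w'])) :=
        ringKrullDim_nonneg_of_nontrivial
      have h2' : ((2 : ℕ∞) : WithBot ℕ∞) ≤ ringKrullDim (X'.presheaf.stalk η') := by
        rw [← hadd]
        calc ((2 : ℕ∞) : WithBot ℕ∞) = 0 + ((2 : ℕ) : WithBot ℕ∞) := by norm_num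
          _ ≤ _ := add_le_add h0 le_rfl
      rw [ringKrullDim_stalk_eq_coheight] at h2'
      have : (2 : ℕ∞) ≤ Order.coheight η' := WithBot.coe_le_coe.mp h2'
      exact lt_of_lt_of_le (by decide) this
    exact (coheight_eq_two_of_specializes hsp₀ hns h2 (hπ.coheight_le_three_of_apply_eq hX hdim
      (apply_eq_of_specializes_of_apply_eq hx hsp₀ hη))).1
  -- the ideal of `L` at `y` and its description through `s`
  set P := stalkIdeal (vanishingIdeal (⟨closure {η'}, isClosed_closure⟩ : Closeds X')) y with hPdef
  have hP : P = primeOfSpecializes hsp := stalkIdeal_vanishingIdeal_closure hsp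
  have hmemP : ∀ t : X'.presheaf.stalk y, t ∈ P ↔ s t ∈ maximalIdeal _ := fun t => by rw [hP]; rfl
  -- `𝔪_x 𝒪_{X',y} ≤ P` (the line lies in the exceptional divisor), hence `G j ∈ P`
  have hEx : (maximalIdeal (X.presheaf.stalk (π y))).map (π.stalkMap y).hom ≤ P := by
    have hE : stalkIdeal ((vanishingIdeal ⟨{x}, hx⟩).comap π) y ≤ P := by
      rw [hP, ← mem_support_iff_stalkIdeal_le_primeOfSpecializes hsp, Scheme.IdealSheafData.support_comap]
      change π η' ∈ ((vanishingIdeal (⟨{x}, hx⟩ : Closeds X)).support : Set X)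
      rw [coe_support_vanishingIdeal, hη]
      rfl
    rw [stalkIdeal_comap_eq_map_stalkMap] at hE
    have hgen : ∀ (z : X) (hz : z = x), stalkIdeal (vanishingIdeal ⟨{x}, hx⟩) z = maximalIdeal _ := by
      rintro z rfl; exact stalkIdeal_vanishingIdeal_singleton hx
    rwa [hgen _ hyx] at hE
  have hGjP : G j ∈ P := hEx (by rw [hmap_y']; exact Ideal.mem_span_singleton_self _)
  -- `G' j = u • G' j'` with `u` a unit (both generate `𝔪_x 𝒪_{η'}`)
  have hGj'0 : G' j' ≠ 0 := hrsop_η'.ne_zero 0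
  obtain ⟨u, hu, hGju⟩ : ∃ u : X'.presheaf.stalk η', IsUnit u ∧ G' j = u * G' j' := by
    have h1 : G j' ∈ Ideal.span {G j} := by
      rw [← hmap_y']
      have := Ideal.mem_map_of_mem (π.stalkMap y).hom (hgmem (π y) hyx hyU j')
      rwa [Scheme.Hom.germ_stalkMap_apply] at this
    obtain ⟨v, hv⟩ := Ideal.mem_span_singleton'.mp h1
    have h2 : G' j ∈ Ideal.span {G' j'} := by
      rw [← hmap_η']
      have := Ideal.mem_map_of_mem (π.stalkMap η').hom (hgmem (π η') hη hηU j)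
      rwa [Scheme.Hom.germ_stalkMap_apply] at this
    obtain ⟨u, hu'⟩ := Ideal.mem_span_singleton'.mp h2
    refine ⟨u, ?_, hu'.symm⟩
    have h3 : G' j' = s v * G' j := by rw [← hsG j', ← hv, map_mul, hsG j]
    have h4 : (s v * u) * G' j' = 1 * G' j' := by rw [mul_assoc, hu', ← h3, one_mul]
    exact IsUnit.of_mul_eq_one_right (s v) (mul_right_cancel₀ hGj'0 h4)
  -- `w ∈ P`: `G' j' * w' = G' j₀ = s (G j * w) = u * G' j' * s w`, so `w' = u * s w` and `s w ∈ 𝔪`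
  have hwP : w ∈ P := by
    rw [hmemP]
    have h1 : G' j₀ = G' j * s w := by rw [← hsG j₀, hrel_y', map_mul, hsG j]
    have h2 : G' j' * w' = G' j' * (u * s w) := by
      rw [← hrel_η', h1, hGju]; ring
    have h3 : w' = u * s w := mul_left_cancel₀ hGj'0 h2
    have hw' : w' ∈ maximalIdeal _ := hrsop_η'.mem_maximalIdeal 1
    rw [h3] at hw'
    exact (Ideal.unit_mul_mem_iff_mem _ hu).mp hw'
  -- the pair `(G j, w)` as a `Fin 2`-family; its ideal `L₀ ≤ P`
  have hrange : Set.range ![G j, w] = {G j, w} := by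
    ext a
    simp only [Set.mem_range, Set.mem_insert_iff, Set.mem_singleton_iff]
    constructor
    · rintro ⟨i, rfl⟩; fin_cases i <;> simp
    · rintro (rfl | rfl); exacts [⟨0, rfl⟩, ⟨1, rfl⟩]
  have hle : Ideal.span (Set.range ![G j, w]) ≤ P := by
    rw [hrange, Ideal.span_le]
    rintro t (rfl | rfl)
    · exact hGjP
    · exact hwP
  refine (le_antisymm hle ?_).symm
  -- `P ≤ L₀`: both prime; `dim 𝒪_y/L₀ = coheight y − 2 ≤ 1`; `P = 𝔪_y` would force `η' = y`
  by_cases hyη : y = η'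
  · -- at the generic point `P = 𝔪 = L₀` (`coheight = 2`)
    have hPm : P = maximalIdeal _ := by
      have hgen : ∀ (z : X') (hz : z = η') (h : η' ⤳ z), primeOfSpecializes h = maximalIdeal _ := by
        rintro z rfl h; exact primeOfSpecializes_refl _
      rw [hP]; exact hgen y hyη hsp
    obtain ⟨e, z, hdim', hz, hzc⟩ := hrsop_y'.exists_rsop
    have hcohy : Order.coheight y = ((2 : ℕ) : ℕ∞) := by rw [hyη, hcohη]; rfl
    have he : e = 0 := by
      have h2 : (maximalIdeal (X'.presheaf.stalk y)).spanFinrank = 2 := spanFinrank_maximalIdeal_stalk_eq y hcohy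
      omega
    subst he
    rw [hPm, ← hz]
    apply Ideal.span_mono
    rintro _ ⟨i, rfl⟩
    exact ⟨i, by rw [← hzc i]; rfl⟩
  · have hns : ¬ y ⤳ η' := fun h' => hyη (Specializes.antisymm h' hsp).eq
    have hcohy : Order.coheight y = 3 :=
      (coheight_eq_two_of_specializes hsp hns (by rw [hcohη]; decide)
        (hπ.coheight_le_three_of_apply_eq hX hdim hyx)).2
    haveI hL₀reg : IsRegularLocalRing (X'.presheaf.stalk y ⧸ Ideal.span (Set.range ![G j, w])) :=
      hrsop_y'.isRegularLocalRing_quotient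
    have hdimq : ringKrullDim (X'.presheaf.stalk y ⧸ Ideal.span (Set.range ![G j, w])) = 1 := by
      have h1 := hrsop_y'.ringKrullDim_quotient_add
      have hcohy3 : Order.coheight y = ((3 : ℕ) : ℕ∞) := by rw [hcohy]; rfl
      have h3 : ringKrullDim (X'.presheaf.stalk y) = (3 : ℕ) := by
        rw [← IsRegularLocalRing.spanFinrank_maximalIdeal, spanFinrank_maximalIdeal_stalk_eq y hcohy3]
      rw [h3] at h1
      obtain ⟨k, hk⟩ := exists_nat_cast_eq_ringKrullDim (R := X'.presheaf.stalk y ⧸ Ideal.span (Set.range ![G j, w]))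
      rw [hk] at h1 ⊢
      have : k + 2 = 3 := by exact_mod_cast h1
      have hk1 : k = 1 := by omega
      rw [hk1]; rfl
    haveI := isDomain_of_isRegularLocalRing (X'.presheaf.stalk y ⧸ Ideal.span (Set.range ![G j, w]))
    haveI : IsPrincipalIdealRing (X'.presheaf.stalk y ⧸ Ideal.span (Set.range ![G j, w])) :=
      isPrincipalIdealRing_of_ringKrullDim_le_one hdimq.le
    haveI hPprime : P.IsPrime := by rw [hP]; infer_instance
    by_contra hne
    have hne' : Ideal.span (Set.range ![G j, w]) ≠ P := fun h => hne h.ge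
    set Q := P.map (Ideal.Quotient.mk (Ideal.span (Set.range ![G j, w]))) with hQdef
    haveI hQ : Q.IsPrime :=
      Ideal.map_isPrime_of_surjective Ideal.Quotient.mk_surjective (by rw [Ideal.mk_ker]; exact hle)
    have hQ0 : Q ≠ ⊥ := by
      intro h0
      rw [hQdef, Ideal.map_eq_bot_iff_le_ker, Ideal.mk_ker] at h0
      exact hne' (le_antisymm hle h0)
    have hQmax : Q.IsMaximal := IsPrime.to_maximal_ideal hQ0
    have hPm : P = maximalIdeal _ := by
      have h1 : Q.comap (Ideal.Quotient.mk _) = P := by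
        rw [hQdef, Ideal.comap_map_of_surjective _ Ideal.Quotient.mk_surjective, ← RingHom.ker_eq_comap_bot,
          Ideal.mk_ker, sup_eq_left.mpr hle]
      have h2 : (maximalIdeal (X'.presheaf.stalk y ⧸ Ideal.span (Set.range ![G j, w]))).comap (Ideal.Quotient.mk _) =
          maximalIdeal _ := by
        rw [maximalIdeal_quotient_eq_map (Ideal.span (Set.range ![G j, w])),
          Ideal.comap_map_of_surjective _ Ideal.Quotient.mk_surjective, ← RingHom.ker_eq_comap_bot, Ideal.mk_ker,
          sup_eq_left]
        exact hrsop_y'.span_range_le_maximalIdeal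
      rw [← h1, IsLocalRing.eq_maximalIdeal hQmax, h2]
    -- `P = 𝔪_y`: the generisation `η'` of `y` is `y` itself
    apply hyη
    have h1 : X'.fromSpecStalk y ⟨primeOfSpecializes hsp, inferInstance⟩ = η' :=
      Literature.AlgebraicGeometry.Motives.fromSpecStalk_comap_maximalIdeal hsp
    have h2 : X'.fromSpecStalk y (IsLocalRing.closedPoint _) = y := Scheme.fromSpecStalk_closedPoint
    have hpt : (⟨primeOfSpecializes hsp, inferInstance⟩ : PrimeSpectrum (X'.presheaf.stalk y)) =
        IsLocalRing.closedPoint (X'.presheaf.stalk y) := PrimeSpectrum.ext (hP.symm.trans hPm)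
    rw [hpt] at h1
    exact h2.symm.trans h1

end Literature.AlgebraicGeometry.Resolution

end
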